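import Literature.Topology.FourManifolds.CappellShanesonSimilarityClasses
import Literature.Topology.FourManifolds.CappellShanesonIdealClasses
import Literature.LinearAlgebra.Matrix.LatimerMacDuffeeDegreeOneIdeals
import HarnessLib

/-!
# Ideals of degree one of `ℤ[Θₙ]` and the standard Cappell–Shaneson matrices: `⟨Θₙ - c, d⟩` (`d ∣ fₙ(c)`)
# are exactly the degree-one ideals, `X_{c,d,n} ∼ C_{fₙ}(d,c)`, `ℤ³_{X_{c,d,n}} ≅ ((d) : ⟨Θₙ - c, d⟩)`, and
# «every Cappell–Shaneson matrix is similar to a standard one» ⟺ «every ideal class of `ℤ[Θₙ]` contains an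
# ideal of degree one»

Topic `Topology/FourManifolds`, namespace `Literature.Topology.FourManifolds`; a consumer of
`CappellShanesonIdealClasses.lean` (KIM–YAMADA's dictionary `X_{c,d,n} ↦ [⟨Θₙ - c, d⟩]`: `csIdeal`, `standardCSMatrix`,
`nonempty_quotModule_transpose_standardCSMatrix_equiv_csIdeal`, `exists_isConj_standardCSMatrix_of_cover`) and of
the general Latimer–MacDuffee–Taussky files `Literature/LinearAlgebra/Matrix/LatimerMacDuffee{Correspondence,
Transpose,DegreeOneIdeals}.lean` (the module `ℤⁿ_A = QuotModule f A hA`; TAUSSKY's transposition theorem;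
KNIGHT–STASINSKI's degree-one ideals `(θ - z, a)` and matrices `C_f(a,z) = knightStasinskiMatrix n f a z`).
Theorems only: no definition, no instance, no notation, no named fact (net Literature debt `0`).

## Sources, VERBATIM

M. H. Kim, S. Yamada, *Ideal classes and Cappell–Shaneson homotopy 4-spheres*, Kyungpook Math. J. 63 (2023) 373–411
[KimYamada2023] (= arXiv:1707.03860, held `paper:arxiv-1707.03860`, chunks p0007–p0008).  **Thm. 2.6** "(Aitchison and
Rubinstein). Every Cappell–Shaneson matrix is similar to a standard Cappell–Shaneson matrix."  **Rem. 2.7**: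
"Technically, Aitchison and Rubinstein proved that every matrix is similar to the transpose of a standard matrix.
However, this is clearly an equivalent statement."  **Prop. 2.14** "([Aitchison–Rubinstein]). There is a one-to-one
correspondence between the set of similarity classes of Cappell–Shaneson matrices with trace `n` and `C(ℤ[Θₙ])`,
which is defined by `X_{c,d,n} = [[0,a,b],[0,c,d],[1,0,n-c]] ↦ [⟨Θₙ - c, d⟩]` where `fₙ(c) ≡ 0 (mod d)`,
`b = (c-1)(n-c-1)` and `ad - bc = 1`", with, just before it: "`(x₁,x₂,x₃) = ((Θₙ-n+c)(Θₙ-c), d, Θₙ-c)` is an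
eigenvector of `A` in `ℤ[Θₙ]³` with the eigenvalue `Θₙ`. […] Hence the ideal class `[⟨Θₙ - c, d⟩]` corresponds to
the standard matrix `X_{c,d,n}`".  I. R. Aitchison, J. H. Rubinstein, *Fibered knots and involutions on homotopy
spheres*, Contemp. Math. 35 (1984) [AitchisonRubinstein1984], Appendix, Theorem A3 (the original of Thm. 2.6).

L. Knight, A. Stasinski, Glasgow Math. J. 66 (2023) 88–103 [KnightStasinski2023] (= arXiv:2205.02094, held), §2
Def. 2.1: "A proper ideal `𝔞` of `𝒪` is said to be of degree one (over `A`) if `A + 𝔞 = 𝒪`"; Lemma 2.2: "the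
embedding `A → A[θ]` induces an isomorphism `A/𝔟 → A[θ]/(θ - z, 𝔟)` and `𝔞 = (θ - z, 𝔟)`"; Lemma 2.3: "`𝔞` is of
degree one if and only if there exists a `z ∈ A` such that `𝔞 = (θ - z, 𝔟)`"; Cor. 2.8 (LENSTRA): "Every ideal
class of `B` [the maximal order] contains an ideal of degree one"; §5 Thm. 5.2: "Let `𝔞` be an ideal of `A[θ]` of
degree one. The similarity class in `Mₙ(A)` that corresponds to the ideal class of `𝔞` under the Latimer–MacDuffee
correspondence contains a matrix of the form `C_f(a,z)`, where `a, z ∈ A` and `f(z) ≡ 0 (mod a)`."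
O. Taussky, J. Number Theory 6 (1974) 64–71 [Taussky1974], §1 p. 64: "the class of the transposed matrix
corresponds to the complementary ideal class."

CONVENTIONS (as in `CappellShanesonIdealClasses`).  `ℤ[Θₙ] = AdjoinRoot (csPoly n)`, `Θₙ = csRoot n`,
`fₙ = csPoly n = X³ - nX² + (n-1)X - 1`; `⟨Θₙ - c, d⟩ = csIdeal c d n`; `X_{c,d,n} = standardCSMatrix c d n h`
(`h : d ∣ fₙ(c)`) in `SL(3, ℤ)`; the module `ℤ³_A = QuotModule (csPoly n) A hA` has `Θₙ` acting on COLUMNS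
(`v ↦ A v`), so KIM–YAMADA's eigenvector statement is `ℤ³_{X_{c,d,n}ᵀ} ≅ ⟨Θₙ - c, d⟩`; «`𝔞` of degree one» is
`Function.Surjective (algebraMap ℤ (ℤ[Θₙ] ⧸ 𝔞))`; «`I ≈ J`» (same class in `C(ℤ[Θₙ])`) is
`∃ x y ≠ 0, (x)·I = (y)·J`.  In KNIGHT–STASINSKI's notation `⟨Θₙ - c, d⟩ = (θ - z, a)` with `θ = Θₙ`, `z = c`,
`a = d`, so their representative of this class is `C_{fₙ}(d,c) = knightStasinskiMatrix 3 (csPoly n) d c`.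

## What is formalised (all for the cubic orders `ℤ[Θₙ]`, `n : ℤ` arbitrary)

* §1 **`surjective_algebraMap_quotient_csIdeal`** (`⟨Θₙ - c, d⟩` is of degree one),
  **`exists_eq_csIdeal_of_surjective`** / `surjective_algebraMap_quotient_iff_exists_eq_csIdeal` (every degree-one
  ideal of `ℤ[Θₙ]` is some `⟨Θₙ - c, d⟩` with `d ∣ fₙ(c)` — so KIM–YAMADA's ideals are exactly KNIGHT–STASINSKI's),
  `comap_csIdeal_eq_span` (`ℤ ∩ ⟨Θₙ - c, d⟩ = dℤ`), `nonempty_quotient_span_ringEquiv_quotient_csIdeal`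
  (`ℤ/d ≅ ℤ[Θₙ]/⟨Θₙ - c, d⟩`), `natCard_quotient_csIdeal` (`[ℤ[Θₙ] : ⟨Θₙ - c, d⟩] = |d|`).
* §2 `aeval_transpose_knightStasinskiMatrix_csPoly`, `nonempty_quotModule_transpose_knightStasinskiMatrix_equiv_csIdeal`
  (`ℤ³_{C_{fₙ}(d,c)ᵀ} ≅ ⟨Θₙ - c, d⟩`), **`exists_conj_standardCSMatrix_knightStasinskiMatrix`** (`X_{c,d,n}` and
  `C_{fₙ}(d,c)` are `GL₃(ℤ)`-conjugate: the two normal forms of the literature represent the same class).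
* §3 **`nonempty_quotModule_standardCSMatrix_equiv_colon`** (`ℤ³_{X_{c,d,n}} ≅ ((d) : ⟨Θₙ - c, d⟩)`: the class of
  the standard matrix itself, in the column convention, is TAUSSKY's complementary class).
* §4 **`exists_isConj_standardCSMatrix_iff`** (a Cappell–Shaneson matrix `A` with `ℤ³_{Aᵀ} ≅ J` is similar to a
  standard matrix iff `J ≈ 𝔞` for an ideal `𝔞` of degree one), **`forall_exists_isConj_standardCSMatrix_iff`**
  (THM. 2.6 / THM. A3 for trace `n` ⟺ every non-zero ideal of `ℤ[Θₙ]` is in the class of an ideal of degree one —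
  the hypothesis of `exists_isConj_standardCSMatrix_of_cover` is also necessary),
  `forall_exists_isConj_standardCSMatrix_iff_transpose` (REM. 2.7: the statement with `X_{c,d,n}` and the one with
  `X_{c,d,n}ᵀ` are equivalent).

NOT formalised: Thm. 2.6 / Thm. A3 itself (AITCHISON–RUBINSTEIN's proof is a direct matrix reduction; by §4 it is
equivalent to a LENSTRA-type statement for the possibly non-maximal orders `ℤ[Θₙ]`), and Cor. 2.8.
-/

open Polynomial
open scoped MatrixGroups Matrix
open Literature.LinearAlgebra.Matrix

noncomputable section

namespace Literature.Topology.FourManifolds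

/-! ### §1 The ideals `⟨Θₙ - c, d⟩`, `d ∣ fₙ(c)`, are exactly the ideals of degree one of `ℤ[Θₙ]` -/

section DegreeOne

variable {n : ℤ}

/-- `fₙ(c) ≠ 0` for every integer `c` (an integer root `x` of `fₙ` would satisfy `x(x² - nx + n - 1) = 1`, so
`x = ±1`, but `fₙ(1) = -1`, `fₙ(-1) = -2n - 1`; AITCHISON–RUBINSTEIN Lemma A4). [folklore] -/
private theorem eval_csPoly_ne_zero (n c : ℤ) : (csPoly n).eval c ≠ 0 := by
  intro hx
  rw [eval_csPoly] at hx
  have h1 : c * (c ^ 2 - n * c + (n - 1)) = 1 := by linear_combination hx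
  rcases Int.eq_one_or_neg_one_of_mul_eq_one h1 with rfl | rfl
  · norm_num at hx
  · have : (2 : ℤ) * n = -1 := by linear_combination -hx
    omega

/-- If `d ∣ fₙ(c)` then `d ≠ 0`. [folklore] -/
private theorem ne_zero_of_dvd_eval {c d : ℤ} (h : d ∣ (csPoly n).eval c) : d ≠ 0 := by
  rintro rfl
  exact eval_csPoly_ne_zero n c (zero_dvd_iff.1 h)

/-- **`⟨Θₙ - c, d⟩` is an ideal of degree one of `ℤ[Θₙ]`**: `ℤ → ℤ[Θₙ]/⟨Θₙ - c, d⟩` is onto (KNIGHT–STASINSKI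
Lemma 2.3: it contains `Θₙ - c`). [cite: KnightStasinski2023, §2 Lemma 2.3, p. 91] [cite: KimYamada2023, Prop. 2.14] -/
theorem surjective_algebraMap_quotient_csIdeal (c d n : ℤ) :
    Function.Surjective (algebraMap ℤ (AdjoinRoot (csPoly n) ⧸ csIdeal c d n)) :=
  (surjective_algebraMap_quotient_iff_exists_root_sub_mem _).2 ⟨c, root_sub_mem_csIdeal c d n⟩

/-- **Every ideal of degree one of `ℤ[Θₙ]` is some `⟨Θₙ - c, d⟩` with `d ∣ fₙ(c)`** (KNIGHT–STASINSKI Lemmas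
2.2–2.3 over the PID `ℤ`, and `fₙ(c) ∈ ℤ ∩ 𝔞 = dℤ`). [cite: KnightStasinski2023, §2 Lemma 2.2 and Lemma 2.3,
pp. 90–91; §4 Prop. 4.2, p. 97] -/
theorem exists_eq_csIdeal_of_surjective {𝔞 : Ideal (AdjoinRoot (csPoly n))}
    (h : Function.Surjective (algebraMap ℤ (AdjoinRoot (csPoly n) ⧸ 𝔞))) :
    ∃ c d : ℤ, d ∣ (csPoly n).eval c ∧ 𝔞 = csIdeal c d n := by
  obtain ⟨c, d, hc, hd, h𝔞⟩ := exists_eq_span_pair_of_surjective h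
  exact ⟨c, d, dvd_eval_of_root_sub_mem hc hd, h𝔞⟩

/-- **The degree-one ideals of `ℤ[Θₙ]` are exactly the `⟨Θₙ - c, d⟩` with `d ∣ fₙ(c)`.**
[cite: KnightStasinski2023, §2 Lemma 2.3, p. 91] [cite: KimYamada2023, Prop. 2.14] -/
theorem surjective_algebraMap_quotient_iff_exists_eq_csIdeal (𝔞 : Ideal (AdjoinRoot (csPoly n))) :
    Function.Surjective (algebraMap ℤ (AdjoinRoot (csPoly n) ⧸ 𝔞)) ↔
      ∃ c d : ℤ, d ∣ (csPoly n).eval c ∧ 𝔞 = csIdeal c d n := by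
  refine ⟨exists_eq_csIdeal_of_surjective, ?_⟩
  rintro ⟨c, d, -, rfl⟩
  exact surjective_algebraMap_quotient_csIdeal c d n

/-- `ℤ ∩ ⟨Θₙ - c, d⟩ = dℤ` when `d ∣ fₙ(c)` (KNIGHT–STASINSKI Lemma 2.3 (i)). [cite: KnightStasinski2023, §2 Lemma 2.3, p. 91] -/
theorem comap_csIdeal_eq_span {c d : ℤ} (h : d ∣ (csPoly n).eval c) :
    (csIdeal c d n).comap (algebraMap ℤ (AdjoinRoot (csPoly n))) = Ideal.span {d} := by
  obtain ⟨m, hm⟩ := h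
  exact comap_span_pair_eq_span hm

/-- **KNIGHT–STASINSKI Lemma 2.2 for `ℤ[Θₙ]`: `ℤ/dℤ ≅ ℤ[Θₙ]/⟨Θₙ - c, d⟩`** (induced by `ℤ ⊂ ℤ[Θₙ]`), when
`d ∣ fₙ(c)`. [cite: KnightStasinski2023, §2 Lemma 2.2, p. 90] -/
theorem nonempty_quotient_span_ringEquiv_quotient_csIdeal {c d : ℤ} (h : d ∣ (csPoly n).eval c) :
    Nonempty ((ℤ ⧸ Ideal.span {d}) ≃+* (AdjoinRoot (csPoly n) ⧸ csIdeal c d n)) := by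
  obtain ⟨m, hm⟩ := h
  exact nonempty_quotient_span_ringEquiv_quotient_span_pair hm

/-- **The index (norm) of `⟨Θₙ - c, d⟩` in `ℤ[Θₙ]` is `|d|`**, when `d ∣ fₙ(c)`.
[cite: KnightStasinski2023, §2 Lemma 2.2, p. 90] [cite: KimYamada2023, Prop. 2.14] -/
theorem natCard_quotient_csIdeal {c d : ℤ} (h : d ∣ (csPoly n).eval c) :
    Nat.card (AdjoinRoot (csPoly n) ⧸ csIdeal c d n) = d.natAbs := by
  obtain ⟨m, hm⟩ := h
  exact natCard_quotient_span_pair hm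

end DegreeOne

/-! ### §2 `X_{c,d,n} ∼ C_{fₙ}(d,c)`: KIM–YAMADA's and KNIGHT–STASINSKI's normal forms agree up to `GL₃(ℤ)` -/

section NormalForms

variable {c d n : ℤ}

/-- **`ℤ³_{C_{fₙ}(d,c)ᵀ} ≅ ⟨Θₙ - c, d⟩`** (KNIGHT–STASINSKI Thm. 5.2 for the cubic `fₙ` and the degree-one ideal
`⟨Θₙ - c, d⟩ = csIdeal c d n`). [cite: KnightStasinski2023, §5 Thm. 5.2, p. 99] [cite: KimYamada2023, Prop. 2.14] -/
theorem nonempty_quotModule_transpose_knightStasinskiMatrix_equiv_csIdeal (h : d ∣ (csPoly n).eval c)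
    (hX : aeval (knightStasinskiMatrix 3 (csPoly n) d c)ᵀ (csPoly n) = 0) :
    Nonempty (QuotModule (csPoly n) (knightStasinskiMatrix 3 (csPoly n) d c)ᵀ hX ≃ₗ[AdjoinRoot (csPoly n)]
      csIdeal c d n) := by
  obtain ⟨m, hm⟩ := h
  exact QuotModule.nonempty_linearEquiv_transpose_knightStasinskiMatrix (natDegree_csPoly n) (by norm_num)
    (ne_zero_of_dvd_eval ⟨m, hm⟩) hm hX

/-- `fₙ(C_{fₙ}(d,c)ᵀ) = 0`. [cite: KnightStasinski2023, §5 Lemma 5.1 and Thm. 5.2, pp. 98–99] -/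
theorem aeval_transpose_knightStasinskiMatrix_csPoly (h : d ∣ (csPoly n).eval c) :
    aeval (knightStasinskiMatrix 3 (csPoly n) d c)ᵀ (csPoly n) = 0 := by
  obtain ⟨m, hm⟩ := h
  exact aeval_transpose_knightStasinskiMatrix_eq_zero (natDegree_csPoly n) (by norm_num) (ne_zero_of_dvd_eval ⟨m, hm⟩) hm

/-- **KIM–YAMADA's standard matrix `X_{c,d,n}` is `GL₃(ℤ)`-conjugate to KNIGHT–STASINSKI's `C_{fₙ}(d,c)`**
(`d ∣ fₙ(c)`): both transposes have Latimer–MacDuffee–Taussky module `⟨Θₙ - c, d⟩` (Prop. 2.14 / Thm. 5.2), so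
`X_{c,d,n}ᵀ ∼ C_{fₙ}(d,c)ᵀ` (TAUSSKY's Theorems 2–3) and conjugacy commutes with transposition.
[cite: KimYamada2023, Prop. 2.14 and Rem. 2.7] [cite: KnightStasinski2023, §5 Thm. 5.2, p. 99] -/
theorem exists_conj_standardCSMatrix_knightStasinskiMatrix (h : d ∣ (csPoly n).eval c) :
    ∃ P : Matrix (Fin 3) (Fin 3) ℤ, IsUnit P.det ∧
      P * (standardCSMatrix c d n h : Matrix (Fin 3) (Fin 3) ℤ) = knightStasinskiMatrix 3 (csPoly n) d c * P := by
  have hX := aeval_transpose_knightStasinskiMatrix_csPoly h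
  obtain ⟨e₁⟩ := nonempty_quotModule_transpose_standardCSMatrix_equiv_csIdeal h
  obtain ⟨e₂⟩ := nonempty_quotModule_transpose_knightStasinskiMatrix_equiv_csIdeal h hX
  have ht := QuotModule.exists_isUnit_det_of_linearEquiv (e₁.trans e₂.symm)
  rw [Matrix.SpecialLinearGroup.coe_transpose] at ht
  exact (exists_conj_transpose_iff _ _).1 ht

end NormalForms

/-! ### §3 `ℤ³_{X_{c,d,n}} ≅ ((d) : ⟨Θₙ - c, d⟩)`: the module of the standard matrix itself -/

section Dual

variable {c d n : ℤ}

/-- **`ℤ³_{X_{c,d,n}} ≅ ((d) : ⟨Θₙ - c, d⟩)`**: by TAUSSKY's theorem (the transposed matrix is the dual class,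
`LatimerMacDuffeeTranspose`) applied to `ℤ³_{X_{c,d,n}ᵀ} ≅ ⟨Θₙ - c, d⟩` (KIM–YAMADA Prop. 2.14) — in the tree's
column convention the class of `X_{c,d,n}` itself is the class of the quotient ideal `((d) : ⟨Θₙ - c, d⟩)`, the
«complementary» class of `⟨Θₙ - c, d⟩`. [cite: KimYamada2023, Prop. 2.14] [cite: Taussky1974, §1, p. 64] -/
theorem nonempty_quotModule_standardCSMatrix_equiv_colon (h : d ∣ (csPoly n).eval c)
    (hX : aeval (standardCSMatrix c d n h : Matrix (Fin 3) (Fin 3) ℤ) (csPoly n) = 0) :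
    Nonempty (QuotModule (csPoly n) (standardCSMatrix c d n h : Matrix (Fin 3) (Fin 3) ℤ) hX ≃ₗ[AdjoinRoot (csPoly n)]
      (Ideal.span {(d : AdjoinRoot (csPoly n))}).colon (csIdeal c d n : Set (AdjoinRoot (csPoly n)))) := by
  obtain ⟨e⟩ := nonempty_quotModule_transpose_standardCSMatrix_equiv_csIdeal h
  have hXtt : aeval (standardCSMatrix c d n h : Matrix (Fin 3) (Fin 3) ℤ)ᵀᵀ (csPoly n) = 0 := by
    rwa [Matrix.transpose_transpose]
  obtain ⟨e'⟩ := QuotModule.nonempty_linearEquiv_transpose_colon (hAt := hXtt) (natDegree_csPoly n) e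
    (intCast_mem_csIdeal c d n) (intCast_ne_zero_csRoot n (ne_zero_of_dvd_eval h))
  have e0 : QuotModule (csPoly n) (standardCSMatrix c d n h : Matrix (Fin 3) (Fin 3) ℤ) hX ≃ₗ[AdjoinRoot (csPoly n)]
      QuotModule (csPoly n) (standardCSMatrix c d n h : Matrix (Fin 3) (Fin 3) ℤ)ᵀᵀ hXtt :=
    QuotModule.linearEquivOfConj (hA := hX) (hB := hXtt) 1 (by rw [Matrix.det_one]; exact isUnit_one)
      (by rw [one_mul, Matrix.transpose_transpose, mul_one])
  exact ⟨e0.trans e'⟩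

end Dual

/-! ### §4 AITCHISON–RUBINSTEIN's Theorem A3 ⟺ every ideal class of `ℤ[Θₙ]` contains an ideal of degree one -/

section StandardForm

variable {n : ℤ}

/-- **A Cappell–Shaneson matrix `A` of trace `n` is similar (in `SL(3, ℤ)`) to a standard matrix iff the
Latimer–MacDuffee–Taussky ideal `J` of `Aᵀ` (`ℤ³_{Aᵀ} ≅ J`) lies in the class of an ideal of degree one**
(`⟸`: the degree-one ideal is `⟨Θₙ - c, d⟩`, KIM–YAMADA Prop. 2.14; `⟹`: `A ∼ X_{c,d,n}` gives `Aᵀ ∼ X_{c,d,n}ᵀ`,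
so `J ≅ ℤ³_{Aᵀ} ≅ ℤ³_{X_{c,d,n}ᵀ} ≅ ⟨Θₙ - c, d⟩`, of degree one). [cite: KimYamada2023, Thm. 2.6, Rem. 2.7 and
Prop. 2.14] [cite: AitchisonRubinstein1984, Appendix, Theorem A3] [cite: KnightStasinski2023, §2 Lemma 2.3, §5 Thm. 5.2] -/
theorem exists_isConj_standardCSMatrix_iff {A : SL(3, ℤ)}
    (hA : aeval ((Matrix.SpecialLinearGroup.transpose A : SL(3, ℤ)) : Matrix (Fin 3) (Fin 3) ℤ) (csPoly n) = 0)
    {J : Ideal (AdjoinRoot (csPoly n))} (hJ : J ≠ ⊥) (eJ : QuotModule (csPoly n) _ hA ≃ₗ[AdjoinRoot (csPoly n)] J) :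
    (∃ (c d : ℤ) (h : d ∣ (csPoly n).eval c), IsConj A (standardCSMatrix c d n h)) ↔
      ∃ 𝔞 : Ideal (AdjoinRoot (csPoly n)), Function.Surjective (algebraMap ℤ (AdjoinRoot (csPoly n) ⧸ 𝔞)) ∧
        ∃ x y : AdjoinRoot (csPoly n), x ≠ 0 ∧ y ≠ 0 ∧ Ideal.span {x} * J = Ideal.span {y} * 𝔞 := by
  constructor
  · rintro ⟨c, d, h, hconj⟩
    refine ⟨csIdeal c d n, surjective_algebraMap_quotient_csIdeal c d n, ?_⟩
    obtain ⟨e⟩ := nonempty_quotModule_transpose_standardCSMatrix_equiv_csIdeal h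
    obtain ⟨P, hP, hPAB⟩ := (isConj_iff_exists_isUnit_det _ _).1 ((isConj_transpose_iff _ _).2 hconj)
    exact (nonempty_linearEquiv_iff_exists_span_singleton_mul_eq hJ).1
      ⟨eJ.symm.trans ((QuotModule.linearEquivOfConj (hA := hA) (hB := aeval_transpose_standardCSMatrix h)
        P hP hPAB).trans e)⟩
  · rintro ⟨𝔞, h𝔞, x, y, hx, hy, hxy⟩
    obtain ⟨c, d, h, rfl⟩ := exists_eq_csIdeal_of_surjective h𝔞
    exact ⟨c, d, h, isConj_standardCSMatrix_of_csIdeal hA eJ h hx hy hxy⟩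

/-- **AITCHISON–RUBINSTEIN Thm. A3 / KIM–YAMADA Thm. 2.6 («Every Cappell–Shaneson matrix is similar to a standard
Cappell–Shaneson matrix») holds for trace `n` IF AND ONLY IF every ideal class of `ℤ[Θₙ]` contains an ideal of
degree one** — the «cover» hypothesis of the tree's `exists_isConj_standardCSMatrix_of_cover` made intrinsic:
`⟸` is that theorem with §1; `⟹`: every nonzero ideal `J` is the module `ℤ³_B` of a matrix root `B` of `fₙ`
(LATIMER–MACDUFFEE), `B` is a Cappell–Shaneson matrix of trace `n` (`χ_B = fₙ`), and §4's criterion for `A = Bᵀ`.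
(By LENSTRA's theorem — KNIGHT–STASINSKI Cor. 2.8, not formalised — the right side holds whenever `ℤ[Θₙ]` is the
maximal order.) [cite: KimYamada2023, Thm. 2.6 and Rem. 2.7] [cite: AitchisonRubinstein1984, Appendix, Theorem A3]
[cite: KnightStasinski2023, §2 Cor. 2.8 and §5 Thm. 5.2] -/
theorem forall_exists_isConj_standardCSMatrix_iff (n : ℤ) :
    (∀ A : SL(3, ℤ), ((A : Matrix (Fin 3) (Fin 3) ℤ) - 1).det = 1 → Matrix.trace (A : Matrix (Fin 3) (Fin 3) ℤ) = n →
        ∃ (c d : ℤ) (h : d ∣ (csPoly n).eval c), IsConj A (standardCSMatrix c d n h)) ↔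
      ∀ J : Ideal (AdjoinRoot (csPoly n)), J ≠ ⊥ →
        ∃ 𝔞 : Ideal (AdjoinRoot (csPoly n)), Function.Surjective (algebraMap ℤ (AdjoinRoot (csPoly n) ⧸ 𝔞)) ∧
          ∃ x y : AdjoinRoot (csPoly n), x ≠ 0 ∧ y ≠ 0 ∧ Ideal.span {x} * J = Ideal.span {y} * 𝔞 := by
  constructor
  · intro hall J hJ
    -- `J ≅ ℤ³_B` for a matrix root `B` of `fₙ`, a Cappell–Shaneson matrix of trace `n`
    obtain ⟨B, hB, ⟨eB⟩⟩ := QuotModule.exists_aeval_eq_zero_and_nonempty_linearEquiv (f := csPoly n)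
      (natDegree_csPoly n) hJ
    have hχ : B.charpoly = csPoly n := (aeval_eq_zero_iff_charpoly_eq (natDegree_csPoly n) (by norm_num) B).1 hB
    obtain ⟨hdet, hdet1, htr⟩ := (charpoly_eq_csPoly_iff B n).1 hχ
    let A : SL(3, ℤ) := Matrix.SpecialLinearGroup.transpose ⟨B, hdet⟩
    have hAt : Matrix.SpecialLinearGroup.transpose A = ⟨B, hdet⟩ := Subtype.ext (Matrix.transpose_transpose B)
    have hA : aeval ((Matrix.SpecialLinearGroup.transpose A : SL(3, ℤ)) : Matrix (Fin 3) (Fin 3) ℤ) (csPoly n) = 0 := by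
      rw [hAt]
      exact hB
    have eA : QuotModule (csPoly n) _ hA ≃ₗ[AdjoinRoot (csPoly n)] J :=
      (QuotModule.linearEquivOfConj (hA := hA) (hB := hB) 1 (by rw [Matrix.det_one]; exact isUnit_one)
        (by rw [one_mul, mul_one, hAt])).trans eB
    refine (exists_isConj_standardCSMatrix_iff hA hJ eA).1 (hall A ?_ ?_)
    · rw [← det_transpose_sub_one, hAt]
      exact hdet1
    · change Matrix.trace (B)ᵀ = n
      rw [Matrix.trace_transpose, htr]
  · intro hcover A hdet htr
    obtain ⟨c, d, h, hconj, -⟩ := exists_isConj_standardCSMatrix_of_cover (fun _ _ ↦ True) (fun J hJ ↦ by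
      obtain ⟨𝔞, h𝔞, x, y, hx, hy, hxy⟩ := hcover J hJ
      obtain ⟨c, d, h, rfl⟩ := exists_eq_csIdeal_of_surjective h𝔞
      exact ⟨c, d, h, x, y, hx, hy, hxy, trivial⟩) A hdet htr
    exact ⟨c, d, h, hconj⟩

/-- **KIM–YAMADA Remark 2.7**: «Technically, Aitchison and Rubinstein proved that every matrix is similar to the
transpose of a standard matrix. However, this is clearly an equivalent statement» — the set of Cappell–Shaneson
matrices of trace `n` is closed under transposition and conjugacy commutes with transposition.
[cite: KimYamada2023, Thm. 2.6 and Rem. 2.7] [cite: AitchisonRubinstein1984, Appendix, Theorem A3] -/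
theorem forall_exists_isConj_standardCSMatrix_iff_transpose (n : ℤ) :
    (∀ A : SL(3, ℤ), ((A : Matrix (Fin 3) (Fin 3) ℤ) - 1).det = 1 → Matrix.trace (A : Matrix (Fin 3) (Fin 3) ℤ) = n →
        ∃ (c d : ℤ) (h : d ∣ (csPoly n).eval c), IsConj A (standardCSMatrix c d n h)) ↔
      ∀ A : SL(3, ℤ), ((A : Matrix (Fin 3) (Fin 3) ℤ) - 1).det = 1 → Matrix.trace (A : Matrix (Fin 3) (Fin 3) ℤ) = n →
        ∃ (c d : ℤ) (h : d ∣ (csPoly n).eval c),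
          IsConj A (Matrix.SpecialLinearGroup.transpose (standardCSMatrix c d n h)) := by
  have htt : ∀ A : SL(3, ℤ), Matrix.SpecialLinearGroup.transpose (Matrix.SpecialLinearGroup.transpose A) = A :=
    fun A ↦ Subtype.ext (Matrix.transpose_transpose _)
  have hcs : ∀ A : SL(3, ℤ), ((A : Matrix (Fin 3) (Fin 3) ℤ) - 1).det = 1 →
      Matrix.trace (A : Matrix (Fin 3) (Fin 3) ℤ) = n →
        (((Matrix.SpecialLinearGroup.transpose A : SL(3, ℤ)) : Matrix (Fin 3) (Fin 3) ℤ) - 1).det = 1 ∧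
          Matrix.trace ((Matrix.SpecialLinearGroup.transpose A : SL(3, ℤ)) : Matrix (Fin 3) (Fin 3) ℤ) = n :=
    fun A hdet htr ↦ ⟨by rw [det_transpose_sub_one]; exact hdet,
      by rw [Matrix.SpecialLinearGroup.coe_transpose, Matrix.trace_transpose, htr]⟩
  constructor
  · intro hall A hdet htr
    obtain ⟨c, d, h, hconj⟩ := hall _ (hcs A hdet htr).1 (hcs A hdet htr).2
    refine ⟨c, d, h, ?_⟩
    rw [← isConj_transpose_iff, htt] at hconj
    exact hconj
  · intro hall A hdet htr
    obtain ⟨c, d, h, hconj⟩ := hall _ (hcs A hdet htr).1 (hcs A hdet htr).2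
    refine ⟨c, d, h, ?_⟩
    rw [← isConj_transpose_iff, htt, htt] at hconj
    exact hconj

end StandardForm

end Literature.Topology.FourManifolds
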